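import Mathlib
import Literature.MathematicalPhysics.QuantumFieldTheory.Balaban1983to89.B13Step237
import Literature.MathematicalPhysics.QuantumFieldTheory.Balaban1983to89.B13Ineq232
import Literature.MathematicalPhysics.QuantumFieldTheory.Balaban1983to89.B13FamilySum
import Literature.MathematicalPhysics.QuantumFieldTheory.Balaban1983to89.DagBinding

/-!
# `Balaban1983to89.B13Carve30Lemma3MainHyp` — [Balaban1988RG2Cluster] pp. 18–22 (Sect. 2, part 2: the displays
# (2.27)–(2.41), LEMMA 3 (2.38) p. 20, the main claim pp. 21–22, the closing remarks — the [26]-step (2.39)–(2.41),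
# the two "last assumptions", the `log Z^{(k)}` half of (I.1.18), gauge invariance, "hence the proof of Theorem I.3"):
# P6 CARVING-FAN BLOCK 30 — the block's residual printed sentences in hypothesis form and ONE hypothesis bundle `Hyp`
# of the pages' printed statements BY NAME, keyed to the consumer (`stmt-QuantumFields-20543`, K2⁷; DAG leaf `b13` of
# `DagBinding.Upstream.ofPrinted` = `B13.Lemma1Printed ∧ Lemma2Printed ∧ Lemma3Printed`, and [II]'s delivered clauses
# `B13.Deliverables` consumed by `B12StepObligation` ∕ `B12StepFromB13`)

statement-level skeleton of published theorems with citation tags; proofs where landed; nothing here is a claim about the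
Yang–Mills mass gap

T. Bałaban, *Renormalization group approach to lattice gauge field theories. II. Cluster expansions*, Commun. Math.
Phys. **116** (1988) 1–22, doi:10.1007/bf01239022 `[Balaban1988RG2Cluster]` (cell paper "B13" = «[II]»; journal page =
PDF page).  STATUS: published, refereed.  PDF held: `paper:balaban1988-cmp116-rg-ii-cluster`; pp. 18–22 read by this
seat AS IMAGES (renders `run/shared/lean/pub/pub-balaban/b2b-balaban-ref1/pages/1988-cmp116-rg-II-cluster/
1988-cmp116-rg-II-cluster-p018-x2.png` … `-p022-x2.png`, 2026-08-28) and on the text layer (`p0018.txt` … `p0022.txt`,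
line locators `pNNNN:Ln` below).  [I] = T. Bałaban, CMP **109** (1987) 249–301 `[Balaban1987RG1]` (B12); a reference
[n] of [II] is entry [n] of [I]'s list: [13] = `[Balaban1985BackgroundPropagators]` (B9), [16] = `[Balaban1985UV3]`
(B10), [26] = C. Cammarota, CMP **85** (1982) 517–528.

CITATION HEADER (lean-in-tree rule).  Cell `lit-balaban` (HOME `run/shared/lean/pub/lit-balaban/`), P6 CARVING FAN
(D-0154 (3b)), block 30 of `carve/BLOCKS-21-30.md` (lead g30, 2026-08-28T05:30Z; assigned to seat `carve-04` g6 by the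
lead's RULING #8, `carve/STATUS.md` 07:30:58Z, CLAIM 07:33:26Z): «[B13] Sect. 2 part 2 pp. 18–22: (2.27)–(2.41), Lemma 3
(2.38) p.20, main claim pp.21–22, closing remarks (Cammarota step, log ½, gauge invariance); 22 SKELETON rows; KEY
stmt-QuantumFields-20543, also-feeds 20544, 20542».  RULES (`carve/CARVE-RULES.md` §2): IN TREE = CITE, NEVER RESTATE;
residual printed statements in hypothesis form `def …Printed : Prop`; ONE bundle `Hyp`; no `instance`, no `notation`,
0 `sorry`.  Neighbour: block 29 (pp. 11–17, (2.1)–(2.26), seat carve-10 g4); the boundary is p. 17 last line ∕ p. 18 l. 1.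

## WHAT THE BLOCK'S PAGES PRINT AND WHERE THE TREE HOLDS IT (cite table — all 22 SKELETON rows of the block are IN
## TREE; nothing in this table is restated below)
* p. 18 ll. 1–7 (lead-in of (2.27)): «We extract the expression α₆exp(−δκd_k(Y)) from each factor in it, where α₆ is a
  sufficiently small, positive constant» — the constant `B13.Consts.α₆` (sign as binders `0 < c.α₆` ∕ `0 ≤ α₆` of the
  assembly theorems below); no statement.
* row B13.Eq2.27 — (2.27) p. 18 (`p0018:L8`) «Σ_{Y∈𝐃}(d_k(Y) + 5) ≥ d_k(Y₀) + 5»: `B13FamilySum.Ineq227` (typed over an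
  abstract catalogue, constant `c`, print `5`) and PROVED on the lattice model with the constant 5,
  `TreeLength.ineq227_treeLen` (sharpened to 2: `TreeLength.treeLen_biUnion_add_two_le`).  Bundle member `Hyp.i227`.
* p. 18 (`p0018:L10`) «Assuming 2E₀ε₁C₁α₄⁻¹α₆⁻¹M^q exp C₂κ₁ exp 5κ ≤ 1, we have (2.28)»: `B13.Consts.R15`; row B13.Eq2.28
  — (2.28): `B13.prod_bound_228` (PROVED).  Bundle member `Hyp.r15`.
* row B13.Eq2.29 — (2.29) p. 18 «For κ sufficiently large and α₆ sufficiently small we have Σ_𝐃 Π_{Y∈𝐃} α₆exp(−δκd_k(Y))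
  ≤ 1» and «Inequalities of this type were proved many times … by a simple modification of the argument in [26]»:
  `B13FamilySum.Ineq229` (typed), PROVED from (1.26) + the additive volume bound as `B13FamilySum.ineq229`,
  `familySum_le_one`, `ineq229_locDomainSys`.  Bundle member `Hyp.i229`.
* row B13.Eq2.30 — (2.30) p. 18 (`p0018:L21`) «(3·2³)⁻¹M⁻⁴|Y| ≤ d_k(Y) ≤ M⁻⁴|Y| − 1»: `B13Ineq230Printed.Ineq230Printed`
  (= `Ineq230Lower ∧ Ineq230Upper`); on the cube model the UPPER half is PROVED (`ineq230Upper_sys`) and the LOWER half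
  is REFUTED as printed (a single cube: `not_ineq230Lower_sys`, `not_ineq230Printed_sys`) and REPAIRED in the additive
  form `M⁻⁴|Y| ≤ c₁(1 + d_k(Y))` (`ineq230Lower_repaired_sys`; `B13FamilySum.VolBound`, `B13.VolBoundK1`).  NOT a member
  of `Hyp` (a refuted hypothesis would make the bundle vacuous on the intended carrier); every use below of «(2.30)» in
  print is served in the tree by the repaired form (binders `hvol` ∕ `h230` ∕ `hN1`).
* row B13.G7 — p. 18 (`p0018:L25–26`) «The definition of Z₀ yields |P| ≥ ½M⁻⁴|Z₀∖Y₀|, because one bond in P may connect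
  two cubes in Z₀∖Y₀»: `B13MayerDecoupling.card_le_two_mul_card_of_cover` (PROVED).
* row B13.Eq2.31 — (2.31) p. 18 with «for g_k², i.e. γ² sufficiently small, depending on M and κ» (`p0018:L31`):
  `B13MayerDecoupling.sum_P_bound_231` (PROVED) and `bound_231_le_one` (the last `≤ 1`, under the smallness binder
  `hsmall : 4M⁴·exp(−(1/10)γ₂ε₁²/g_k²) ≤ (1/20)γ₂ε₁²/g_k²` that «sufficiently small» names); `B13Lemma3Assembly.psum_le_231`.
* row B13.Eq2.32 — (2.32) p. 18 «Σ_i d_k(Y_i) + 4M⁻⁴|Z₀∖Y₀| ≥ d_k(Z₀)» («By a simple geometric argument»):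
  `B13Ineq232.Ineq232Printed` (typed on the datum `B13Ineq232.CompData`), REFUTED with the printed constant 4 at d = 4
  (`B13Ineq232Star.not_ineq232Printed_star_four`; 3 ≤ d: `not_ineq232Printed_star`) and PROVED with the constant 17
  (`B13Ineq232TreeLength.ineq232_treeLen_four`; general `B13Ineq232.ineq232_subst`).  NOT a member of `Hyp` (same reason
  as (2.30)); the repaired constant feeds `B13.Consts.R16repaired` ∕ `B13Ineq232.seventeen_rate_le_of_R16repaired`.
* p. 18 last line – p. 19 l. 2 (`p0018:L35–36`, `p0019:L2`) «Assuming (1/20)γ₂ε₁²/g_k² ≥ (1/20)γ₂ε₁²/γ² ≥ 4κ, and denoting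
  ε₂ = 2E₀ε₁C₁α₄⁻¹α₆⁻¹M^q exp C₂κ₁, we obtain (2.33)»: `B13.Consts.R16` (the second `≥`; the first `≥` is `g_k ≤ γ` of
  Theorem I.3 — `r16_at_gk` below, PROVED), `B13.Consts.eps2` ∕ `eps2_printed`; row B13.Eq2.33 — (2.33):
  `B13Ineq232TreeLength.case_nonempty_233_treeLen` (Y₀ ≠ ∅, PROVED with the repaired joining constant), `B13.case_empty_233`
  (Y₀ = ∅), `B13Lemma3Assembly.ysum_term_le_233`.  Bundle member `Hyp.r16`.
* p. 19 l. 4 and ll. 5–6 — TWO RESIDUAL SENTENCES, §1 below (`Eps2LeOnePrinted`, `ExpLeEps2Printed`).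
* row B13.Eq2.34 — (2.34) p. 19: `B13.sum_powerset_le_exp_234` (PROVED), `B13Lemma3Assembly.ysum_le_234`.  The next
  sentence (`p0019:L11–12`) «The exponential on the right-hand side multiplied by exp(−δκd_k(Z₀)) can be estimated by 1» is
  NOT typed: as printed it rests on the lower half of (2.30) (false for a one-cube Z₀, d_k(Z₀) = 0); the tree carries the
  step inside `B13Lemma3Assembly.innerSum_le_235` with the repaired volume bookkeeping (binders `h230`, `hN1`).
* row B13.Eq2.35 — (2.35) p. 19: `B13Lemma3Assembly.innerSum_le_235` (PROVED assembly of (2.28)–(2.34)); on the torus ∕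
  window carriers `B13Lemma3TorusTerms.inner`, `B13Lemma3WindowTerms.inner`.
* p. 19 ll. 18–27 (the Z′ construction «we denote by Z′_i the smallest localization domain from 𝐃_{k+1} containing Z̃_i»):
  `B13Geometry236.closureDom`, `B13ScaleTransfer.closureIdx`, `B13Lemma3TorusTerms.clSet` (definitions); the carrier
  field `Carriers.cl` below.
* row B13.Eq2.36 — (2.36) p. 19 (`p0019:L28`) «2d_k(Z_i) ≥ Ld_{k+1}(Z′_i). This inequality can be obtained by simple, but
  awkward, geometric and combinatoric considerations»: `B13.Ineq236Printed` (typed; UNPROVED in print — the cell's PROVED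
  substitutes carry the factor `L∕a(L)` (`B13.Consts.aL`, GEOMETRY-236) resp. `L∕10881` (`B13ScaleTransfer.ScaleTransfer`,
  `exp_transfer_four`), and every closing theorem exists for a general factor ℓ: `B13.Lemma3With`, `Bound238With`,
  `deliverables_of_chainWith`); its single use p. 20 ll. 2–3: `B13.exp_transfer_of_ineq236With` (PROVED).  Bundle member
  `Hyp.i236` (as printed, ℓ = L∕2).
* p. 19 l. 31 – p. 20 l. 6 (n components; «estimated using (1.28), with κ replaced by δκ, and with an additional sum over
  (L+2)⁴ cubes □′»; «This yields a bound similar to (2.35), with ε₂ replaced by (L+2)⁴O(1)ε₂, and (1 − 5δ)κd_k(Z_i) …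
  replaced by (1 − 6δ)½Lκd_{k+1}(Z′_i)»; «The sum over n ≥ 1 is now bounded by 2(L+2)⁴O(1)ε₂, assuming that (L+2)⁴O(1)ε₂ ≤
  ½»): `B13Step237.merge_price`, `familyStep`, `familyStep_printedBracket`, `memberF`, `bracketF`, `nsum_le_two_mul`
  (row B13.Eq2.37, PROVED), `B13Step237.R18half` (the printed «≤ ½»), `B13Lemma3Assembly.compSum_le_two_mul`,
  `anchored_sum_le`, `famSum_le_237`.  Bundle member `Hyp.r18half`.
* p. 20 ll. 6–16 («Finally, the sum over all families … is estimated using (2.29) … The inequality (2.27) is used …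
  Assuming that 2(L+2)⁴O(1)ε₂ exp 5κ ≤ 1, we obtain for a fixed Z′₀, (2.37)»): `B13Step237.R18` (printed) ∕ `R18sharp`
  (what the step consumes, NOT printed), `B13Lemma3Assembly.famSum_le_237`, row B13.Eq2.37b (`p0020:L17–20`, «Using the
  inequality (2.32), properly adapted to the new situation …»): `B13Ineq232TreeLength.adapted_p20_treeLen`,
  `B13Ineq232.adapted_p20` (PROVED).  Bundle member `Hyp.r18`.
* p. 20 l. 20 (`p0020:L20`) «Of course, we assume that ½(κ₁ − 1) ≥ 2Lκ»: `B13Ineq232.R20` (printed), `R20With`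
  (repaired constants).  Bundle member `Hyp.r20`.
* p. 20 ll. 20–23 («The sum over Z∖Z′₀ is bounded … by exp(exp(−½(κ₁ − 1))(LM)⁻⁴|Z|). This exponential is of the same type
  as the last exponential in (2.37), which can be written as expO(1)(LM)⁴α₅(LM)⁻⁴|Z|»): `B13Bound238Assembly.term_le_237`,
  `sum_exp_card_le`, `norm_sum_le_238` (PROVED); `B13Lemma3Torus.wZ` ∕ `B13Lemma3Window.wZ`.
* p. 20 ll. 24–27 — RESIDUAL (the recalled definition of α₅ and «Then O(1)(LM)⁴α₅ + exp(−½(κ₁ − 1)) is bounded by an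
  absolute constant»), §1 below (`Alpha5RecallPrinted`, `absConst20_of_R21` PROVED); the assumption between them, «We assume
  that (LM)⁴α₀, (LM)⁴α₁, (LM)⁴α₄, (LM)⁴γ₂ are bounded by a constant independent of M, for example by 1»: `B13.Consts.R21`,
  `perSite_absolute_of_R21`.  Bundle member `Hyp.r21`.
* p. 20 ll. 28–30 («We use the factor exp(−δ½Lκd_{k+1}(Z)), and the inequality (2.30), to bound the exponentials by 1. We
  leave one factor 2(L+2)⁴O(1)ε₂»): inside `B13Bound238Assembly.bound238_of_237` ∕ `bound238With_of_237` (row B13.Eq2.38,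
  PROVED from (2.37) with the REPAIRED (2.30) at scale k + 1); `p0020:L30–31` «We define the constant C₃ =
  2(L+2)⁴O(1)2E₀C₁α₄⁻¹α₆⁻¹M^q exp C₂κ₁»: `B13.Consts.C3act`, `C3act_printed`, `C3act_mul_eps1`, `B13Step237.bracketF_A1`.
* row B13.Lem3 ∕ B13.Eq2.38 — LEMMA 3 p. 20 (`p0020:L34–36`): `B13.Lemma3Printed` (verbatim; `S.Restr → B13.Bound238 S c`),
  `B13.Bound238`, and its ASSEMBLY from the displayed steps `B13Bound238Assembly.bound238_of_237`,
  `B13Lemma3Assembly.bound238With_of_226`, `lemma3Printed_of_bound238With_half`, on the torus ∕ window carriers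
  `B13Lemma3Torus.bound238With_torus`, `B13NodeTorus.bound238_torus`, `B13Lemma3Window…` (PROVED modulo the named leaves
  of those modules).  Bundle members `Hyp.restr`, `Hyp.lemma3`; `Hyp.bound238`.
* p. 20 ll. 37–38 «The above lemma implies that sufficient conditions for convergence of the series (2.12), (2.13) are
  satisfied, see [26,67,25,50]»: made quantitative and PROVED in `B13Eq240Printed.summable_absTerm213_w239`,
  `summable_ursellAbsTermIn_of_small`, `ursellSeries213_eq_locE_of_small`; Kotecký–Preiss route `B13UrsellKP`,
  `B13UrsellKPSeries`, `B13Resummation.norm_locE_le_of_small`.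
* rows B13.Eq2.39, B13.Eq2.40, B13.Eq2.41, B13.CammarotaStep — (2.39)–(2.41) p. 21 with «To the above sum we can repeat
  all the considerations and bounds of the paper [26], for κ sufficiently large, and ε₁ sufficiently small» and «The last
  sum is bounded by C₃ε₁exp5κO(1)(LM)⁻⁴|X| ≤ C₃ε₁exp5κO(1)exp(LM)⁻⁴|X|, and the last exponential multiplied by
  exp(−½δLκd_{k+1}(X)) is bounded by 1»: `B13.CammarotaStep` ((2.38) ⇒ (2.41) as ONE hypothesis, the tree's reading of
  the by-reference step), `B13.Bound241` ((2.41) verbatim), and the [26]-route PROVED in the printed letters: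
  `B13Eq240Printed.ineq239`, `ineq240`, `sum240_le_card`, `card_le_exp`, `exp_card_mul_exp_neg_le` (the «bounded by 1»
  holds as «by e^{c₁}» under the repaired (2.30)), `ineq241_of_239`, `norm_ursellSeries213_le`, `cammarotaStep_of_treeGraph`;
  typed leaf form `B13Ineq240.Ineq240`; KP certificate `B13Resummation.cammarotaStepWith_of_KP`.  Bundle member
  `Hyp.step26`; `Hyp.bound241`.
* p. 21 ll. 16–20 («At first we assume that (1 − 10δ)½L = 1, or δ = (1/10)(1 − 2L⁻¹). Next, we assume that O(1)C₃ε₁ ≤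
  ½E₀. In fact this assumption is unessential …»): `B13.Consts.R22`, `R22_iff_delta`, `delta_bounds_of_R22`,
  `rate239_of_R22` (the located rate slip of (2.39)), `B13.Consts.R23`, `R23_iff`.  Bundle members `Hyp.r22`, `Hyp.r23`.
* row B13.Eq2.41b — p. 21 ll. 21–22 «The inequality (2.41) and the assumptions imply the inequality (I.1.18), with ½E₀
  instead of E₀, for the terms of the effective action E^{(k+1)} in (I.1.3)»: `B13.bound118_of_bound241` (PROVED; general
  ℓ: `bound118_of_bound241With`; `B13Eq240Printed.bound118_of_treeGraph`, `B13Resummation.bound118_of_KP`,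
  `B12StepFromB13.NewTermLeaves.bound118`).  `Hyp.bound118_newTerm`.
* p. 21 ll. 22–24 «The effective action in (I.1.6) is obtained by adding to the above action the expression
  [log Z^{(k)}(U_{k+1}) − log Z^{(k)}(1)]»: `B13.StepData.Etot` (definition).
* row B13.LogHalf — p. 21 ll. 25–32 («For this expression we construct the representation (I.1.7) using the generalized
  random walk expansion for Z^{(k)}(U_{k+1}) … [16], see the formula (63) there … we extend them to analytic functions of
  U, J. The expression localized in X satisfies the bound (I.1.18) with κ replaced by δ₀M, and with an absolute constant
  instead of E₀. We define ½E₀ as equal to this constant, and we take M sufficiently large, so that δ₀M ≥ κ. This yields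
  the bounds (I.1.18) for terms of the effective action in the representation (I.1.6) also.»): the carrier field
  `B13.StepData.Repr17`; the LITERAL bound as the binder `hlog` of `B13.deliverables_of_chain` — named below as
  `LogHalf118Printed` (§1, an instance of `B13.Bound118` at the printed parameters, nothing new); the tree's per-LM-cube
  LEAF `B13.LogHalfBound` with `B13.VolBoundK1`, `bound118_of_logHalfBound`, `bound118_of_logHalfBound_literal`
  (PROVED), its second-order ∕ two-regime discharge route `B13DerivZeroGauge.logHalfBound_secondOrder_twoRegime_of_linearInvariant`
  (the decl the SKELETON row's truncated cite `…_of_line` points at), `B13LogHalfRadius.LogHalfBoundLin`,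
  `logHalfBound_of_lin`, `bound118_of_R21_radius`, `B10Eq61PerSite.*`; «δ₀M ≥ κ»: `B13.Consts.R24` (printed), `R24sharp`
  (per-cube form, not printed); the two halves ⇒ (I.1.18): `B13.bound118_of_halves` (PROVED).  Bundle members
  `Hyp.repr17`, `Hyp.analyticLog`, `Hyp.logHalf`, `Hyp.r24`; `Hyp.bound118_total`.
* row B13.Gauge — p. 21 l. 33 – p. 22 l. 4 («By Lemma 2, and the transformation properties of the operators in (2.14) with
  respect to gauge transformations, e.g. see (3.28)–(3.34) [13], the expressions (2.14) are gauge invariant with respect to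
  all G-valued transformations. The expressions are analytic functions of (U, J), hence the invariance can be extended, by
  the analyticity, to Gᶜ-valued gauge transformations in a small neighborhood of the space of G-valued ones. This means
  that the expressions are constant on intersections of orbits with the corresponding space of configurations (U, J)
  satisfying the conditions I.(i)–(iv). We extend them to constant functions on whole orbits having non-empty
  intersections with the space.»): the MECHANISM PROVED in `B13Inv214Orbit` — `gcInvariant_of_gInvariant`,
  `gcInvariant_of_analyticOn` (G-invariance + analyticity ⇒ Gᶜ-invariance near G, under the one-variable identity
  `TubeIdentity`), `NearOrbitConstOn`, `OrbitConstOn`, `orbitConstOn_of_gInvariant`, `exists_orbitExtension` («We extend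
  them to constant functions on whole orbits»), with the non-vacuity toy `toy_gInvariant_not_gcInvariant`; SU(N) letters
  `B13Inv214OrbitSUN`; the delivered clause `B13.Deliverables.gauge`.  Bundle member `Hyp.gauge`.
* p. 22 ll. 5–6 «The above remark completes the proof of the inductive assumptions for the action A_{k+1}, hence the proof
  of Theorem I.3»: `B13.Deliverables`, `deliverables_of_chain` (PROVED bookkeeping), `B13.SmallFieldStep`, `indAss_all`,
  `smallFieldStep_of_parts`, `DagBinding.smallField_of_B13step`; the edge to [I] Theorem 3: `B12StepObligation.StepDict`,
  `sfNewTerm_of_deliverables`, `B12StepFromB13.NewTermLeaves`, `TotalLeaves`, `KPNumerics`, `ClosingNumerics`,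
  `sfNewTerm_of_totalLeaves`, `b12Thm3Shape_of_windows_total`.  `Hyp.deliverables`, `Hyp.dag_b13`.

## WHAT THIS FILE ADDS
§1 FOUR RESIDUAL PRINTED SENTENCES with no declaration of record (searched 2026-08-28: `HOME/EXISTING-DECLS.tsv` rows of
`Balaban1988RG2Cluster` with locators p. 18–22 ∕ (2.27)–(2.41), and `rg` over `Balaban1983to89/B13*.lean` for «ε₂ ≤ 1»,
«exp(−(1/20)», «α₅ =», «absolute constant»; found only as theorem BINDERS `hε₁ : ε₂ ≤ 1`, `hR17 : exp(−a/20) ≤ ε₂`, `hlog`,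
or inside docstrings), typed in hypothesis form on the cell's constants record `B13.Consts` ∕ step carrier `B13.StepData`,
each with a kernel-checked companion:
* `Eps2LeOnePrinted` — p. 19 l. 4 «We have used the assumption ε₂ ≤ 1» (`eps2LeOne_of_R15`: it FOLLOWS from the p. 18
  restriction R15 once κ ≥ 0, PROVED);
* `ExpLeEps2Printed` — p. 19 ll. 5–6 «For simplicity let us assume that exp(−(1/20)γ₂ε₁²/γ²) ≤ ε₂» (`expLeEps2_at_gk`: the
  form at the running coupling `g_k ≤ γ` that the assembly theorems consume as `hR17`, PROVED; `r16_at_gk` likewise for R16);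
* `Alpha5RecallPrinted` — p. 20 ll. 24–25 «Let us recall the definition of the constant α₅: α₅ = O(1)e^{−1/3δ₀M} + O(α₀ +
  α₁) + O(1)α₄ + γ₂» with the three O(·) constants explicit, and `absConst20_of_R21` — p. 20 ll. 26–27 «Then O(1)(LM)⁴α₅ +
  exp(−½(κ₁ − 1)) is bounded by an absolute constant»: PROVED with the explicit M-INDEPENDENT constant
  `O(1)·(1944·A₃L⁴∕δ₀⁴ + 2A₄ + A₅ + 1) + exp(−½(κ₁ − 1))` (via `pow_four_mul_exp_neg_le`: `M⁴e^{−δ₀M∕3} ≤ 1944∕δ₀⁴`);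
* `LogHalf118Printed` — p. 21 ll. 28–31, the LITERAL log-half sentence «(I.1.18) with κ replaced by δ₀M, and with [½E₀]»
  = `B13.Bound118 S.Dk1 S.sp2 S.Elog (½E₀) (δ₀M)` by name (`logHalf118Printed_iff`; `logHalf118_of_perCube`: it follows
  from the tree's per-LM-cube leaf `B13.LogHalfBound` at rate δ₀M + 1 with `B13.VolBoundK1` and `B·c₁ ≤ ½E₀`, PROVED).
§2 THE BUNDLE.  `Carriers S Cube` — the data the pages' statements take beyond `(S, c)` (cube footprints of the domains
of 𝐃_k for (2.27)/(2.29), the closure map Z ↦ Z′ of p. 19 for (2.36), the three O(·) constants of α₅); `Hyp S c X` — the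
printed statements of pp. 18–22 AS HYPOTHESES, BY NAME, in page order; consumer forms: `Hyp.bound238` ((2.38)),
`Hyp.bound241` ((2.41)), `Hyp.bound118_newTerm` ((I.1.18) with ½E₀ for E^{(k+1)}, p. 21), `Hyp.bound118_total` ((I.1.18)
for the representation (I.1.6), p. 21), `Hyp.deliverables` (`B13.Deliverables`, pp. 20–22, given the p. 15 analyticity
of block 29), `Hyp.dag_b13` (the DAG's `b13` leaf of `DagBinding.Upstream.ofPrinted` at `(X.S13, X.c13)`, given Lemmas 1–2
of pp. 9–11), `Hyp.expLeEps2_gk` ∕ `Hyp.r16_gk` (the p. 18–19 restrictions at the running coupling).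

## HONEST SCOPE
Nothing of [II] is proved here beyond real arithmetic and bookkeeping; Lemma 3, the [26]-step (2.39)–(2.41), the
log Z^{(k)} half, (I.1.7) and the gauge-invariance clause are NOT re-proved (hypothesis slots by name, exactly as in
`B13.deliverables_of_chain` ∕ `DagBinding`); (2.30) and (2.32) are cited, not bundled, because the tree REFUTES them as
printed on the cube model (their repaired forms are PROVED there); (2.36) is bundled AS PRINTED although unproved in print
(the tree's closing theorems hold for any transfer factor ℓ > 1).  No summit statement is proved by this seat;
count-neutral; nothing continuum ∕ ℝ⁴ ∕ OS ∕ mass-gap ∕ Clay.  No `sorry`, no `instance`, no `notation`.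
-/

namespace Literature.MathematicalPhysics.QuantumFieldTheory.Balaban1983to89.B13Carve30Lemma3MainHyp

/-! ## §1  Residual printed sentences of pp. 19–21 (hypothesis form) with kernel-checked companions -/

section Residual

variable (c : B13.Consts)

/-- **p. 19, l. 4 [PDF 19]** (`p0019:L4`), verbatim: «We have used the assumption ε₂ ≤ 1, and the fact that if Y₀ is empty,
then we have the exponential factor.» — the first clause, on the p. 19 product `ε₂ = 2E₀ε₁C₁α₄⁻¹α₆⁻¹M^q exp C₂κ₁`
(`B13.Consts.eps2`).  In the tree only as theorem binders (`hε₁ : ε₂ ≤ 1` of `B13Ineq232.case_nonempty_233`,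
`B13Ineq232TreeLength.case_nonempty_233_treeLen`).  It is a CONSEQUENCE of the p. 18 restriction `B13.Consts.R15`
(`eps2LeOne_of_R15`). [cite: Balaban1988RG2Cluster, p.19 l.4 (after (2.33))] -/
def Eps2LeOnePrinted : Prop := c.eps2 ≤ 1

/-- Unfolding. [cite: Balaban1988RG2Cluster, p.19 l.4 (after (2.33))] -/
theorem eps2LeOnePrinted_iff : Eps2LeOnePrinted c ↔ c.eps2 ≤ 1 := Iff.rfl

/-- «the assumption ε₂ ≤ 1» follows from R15 «2E₀ε₁C₁α₄⁻¹α₆⁻¹M^q exp C₂κ₁ exp 5κ ≤ 1» (p. 18) as soon as `κ ≥ 0`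
(`exp 5κ ≥ 1`).  PROVED. [cite: Balaban1988RG2Cluster, p.19 l.4 and p.18 (before (2.28))] -/
theorem eps2LeOne_of_R15 (hκ : 0 ≤ c.κ) (h15 : c.R15) : Eps2LeOnePrinted c := by
  unfold Eps2LeOnePrinted
  have h' : c.eps2 * Real.exp (5 * c.κ) ≤ 1 := h15
  have hexp : 1 ≤ Real.exp (5 * c.κ) := Real.one_le_exp (by positivity)
  by_cases hs : 0 ≤ c.eps2
  · calc c.eps2 = c.eps2 * 1 := (mul_one _).symm
      _ ≤ c.eps2 * Real.exp (5 * c.κ) := mul_le_mul_of_nonneg_left hexp hs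
      _ ≤ 1 := h'
  · linarith

/-- **p. 19, ll. 5–6 [PDF 19]** (`p0019:L5–L6`), verbatim: «For simplicity let us assume that exp(−(1/20)γ₂ε₁²/γ²) ≤ ε₂.» —
on `B13.Consts` (`γ₂`, `ε₁`, `γ` of Theorem I.3, `ε₂ = B13.Consts.eps2`), the exponent written as in `B13.Consts.R16`.  In
the tree only as the binder `hR17 : Real.exp (-(a / 20)) ≤ c.eps2` (a = γ₂ε₁²/g_k²) of `B13Lemma3Assembly.innerSum_le_235`,
`bound238With_of_226`, `B13Lemma3Torus.bound238With_torus`, …; `expLeEps2_at_gk` produces that binder from this sentence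
and `g_k ≤ γ`. [cite: Balaban1988RG2Cluster, p.19 ll.5–6 (after (2.33))] -/
def ExpLeEps2Printed : Prop := Real.exp (-(c.γ₂ * c.ε₁ ^ 2 / c.γ ^ 2 / 20)) ≤ c.eps2

/-- Unfolding. [cite: Balaban1988RG2Cluster, p.19 ll.5–6 (after (2.33))] -/
theorem expLeEps2Printed_iff :
    ExpLeEps2Printed c ↔ Real.exp (-(c.γ₂ * c.ε₁ ^ 2 / c.γ ^ 2 / 20)) ≤ c.eps2 := Iff.rfl

/-- The p. 18 monotonicity «(1/20)γ₂ε₁²/g_k² ≥ (1/20)γ₂ε₁²/γ²» (the one place `g_k ≤ γ` of Theorem I.3 enters, p. 18 last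
line): for `0 < g ≤ γ` and `γ₂ε₁² ≥ 0`.  PROVED. [cite: Balaban1988RG2Cluster, p.18 (after (2.32))] -/
theorem quotient_mono_gk {g : ℝ} (hg : 0 < g) (hgγ : g ≤ c.γ) (hnum : 0 ≤ c.γ₂ * c.ε₁ ^ 2) :
    c.γ₂ * c.ε₁ ^ 2 / c.γ ^ 2 / 20 ≤ c.γ₂ * c.ε₁ ^ 2 / g ^ 2 / 20 := by
  have hg2 : 0 < g ^ 2 := by positivity
  have hle : g ^ 2 ≤ c.γ ^ 2 := pow_le_pow_left₀ hg.le hgγ 2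
  have h := div_le_div_of_nonneg_left hnum hg2 hle
  linarith

/-- «exp(−(1/20)γ₂ε₁²/g_k²) ≤ ε₂» at every running coupling `0 < g_k ≤ γ`, from the printed assumption at `γ` — the
binder `hR17` of the tree's (2.33)–(2.35) assembly.  PROVED. [cite: Balaban1988RG2Cluster, p.19 ll.5–6 and p.18 (after (2.32))] -/
theorem expLeEps2_at_gk (h : ExpLeEps2Printed c) {g : ℝ} (hg : 0 < g) (hgγ : g ≤ c.γ)
    (hnum : 0 ≤ c.γ₂ * c.ε₁ ^ 2) : Real.exp (-(c.γ₂ * c.ε₁ ^ 2 / g ^ 2 / 20)) ≤ c.eps2 := by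
  have hmono := quotient_mono_gk c hg hgγ hnum
  have hexp : Real.exp (-(c.γ₂ * c.ε₁ ^ 2 / g ^ 2 / 20)) ≤ Real.exp (-(c.γ₂ * c.ε₁ ^ 2 / c.γ ^ 2 / 20)) :=
    Real.exp_le_exp.mpr (by linarith)
  exact hexp.trans h

/-- R16 «(1/20)γ₂ε₁²/g_k² ≥ (1/20)γ₂ε₁²/γ² ≥ 4κ» at every running coupling `0 < g_k ≤ γ` (the binder `hR16`-type
hypothesis `4κ ≤ a/20` of `B13.case_empty_233`).  PROVED. [cite: Balaban1988RG2Cluster, p.18 (after (2.32))] -/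
theorem r16_at_gk (h16 : c.R16) {g : ℝ} (hg : 0 < g) (hgγ : g ≤ c.γ) (hnum : 0 ≤ c.γ₂ * c.ε₁ ^ 2) :
    4 * c.κ ≤ c.γ₂ * c.ε₁ ^ 2 / g ^ 2 / 20 := by
  have h16' : 4 * c.κ ≤ c.γ₂ * c.ε₁ ^ 2 / c.γ ^ 2 / 20 := h16
  exact h16'.trans (quotient_mono_gk c hg hgγ hnum)

/-- **p. 20, ll. 24–25 [PDF 20]** (`p0020:L24–L25`), verbatim: «Let us recall the definition of the constant α₅: α₅ =
O(1)e^{−1/3δ₀M} + O(α₀ + α₁) + O(1)α₄ + γ₂.» (the definition displayed with (2.23), p. 17).  TYPED in hypothesis form on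
`B13.Consts` (whose `α₅` is a free field) as the BOUND the O(·)-expression asserts, with its three O(·) constants explicit:
`α₅ ≤ A₃e^{−δ₀M∕3} + A₄(α₀ + α₁) + A₅α₄ + γ₂` (`A₃` = the first O(1), `A₄` = the constant of «O(α₀ + α₁)», `A₅` = the
second O(1); the literal «=» with some such constants is the special case `le_of_eq`). [cite: Balaban1988RG2Cluster, p.20 ll.24–25 (recalling (2.23) p.17)] -/
def Alpha5RecallPrinted (A₃ A₄ A₅ : ℝ) : Prop :=
  c.α₅ ≤ A₃ * Real.exp (-(c.δ₀ * c.M / 3)) + A₄ * (c.α₀ + c.α₁) + A₅ * c.α₄ + c.γ₂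

/-- Unfolding. [cite: Balaban1988RG2Cluster, p.20 ll.24–25] -/
theorem alpha5RecallPrinted_iff (A₃ A₄ A₅ : ℝ) :
    Alpha5RecallPrinted c A₃ A₄ A₅ ↔
      c.α₅ ≤ A₃ * Real.exp (-(c.δ₀ * c.M / 3)) + A₄ * (c.α₀ + c.α₁) + A₅ * c.α₄ + c.γ₂ := Iff.rfl

/-- The literal reading «α₅ = …» (with explicit constants) gives the typed bound. [cite: Balaban1988RG2Cluster, p.20 ll.24–25] -/
theorem alpha5RecallPrinted_of_eq {A₃ A₄ A₅ : ℝ}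
    (h : c.α₅ = A₃ * Real.exp (-(c.δ₀ * c.M / 3)) + A₄ * (c.α₀ + c.α₁) + A₅ * c.α₄ + c.γ₂) :
    Alpha5RecallPrinted c A₃ A₄ A₅ := le_of_eq h

/-- Calculus behind p. 20's «bounded by an absolute constant» (independent of M): `M⁴e^{−δ₀M∕3} ≤ 1944∕δ₀⁴` for
`M ≥ 0`, `δ₀ > 0` (from `x⁴∕4! ≤ eˣ`, `Real.pow_div_factorial_le_exp`, at `x = δ₀M∕3`; 1944 = 81·24) — the first summand
of `(LM)⁴α₅` in `absConst20_of_R21`.  PROVED. [cite: Balaban1988RG2Cluster, p.20 ll.26–27 (before the definition of C₃)] -/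
theorem pow_four_mul_exp_neg_le {M δ₀ : ℝ} (hM : 0 ≤ M) (hδ₀ : 0 < δ₀) :
    M ^ 4 * Real.exp (-(δ₀ * M / 3)) ≤ 1944 / δ₀ ^ 4 := by
  have hx : 0 ≤ δ₀ * M / 3 := by positivity
  have h4 := Real.pow_div_factorial_le_exp (δ₀ * M / 3) hx 4
  have hfact : ((Nat.factorial 4 : ℕ) : ℝ) = 24 := by norm_num [Nat.factorial]
  rw [hfact] at h4
  have hpow : (δ₀ * M / 3) ^ 4 = δ₀ ^ 4 * M ^ 4 / 81 := by ring
  rw [hpow] at h4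
  have key : δ₀ ^ 4 * M ^ 4 ≤ 1944 * Real.exp (δ₀ * M / 3) := by
    rw [div_div, div_le_iff₀ (by norm_num : (0 : ℝ) < 81 * 24)] at h4
    linarith
  have hδ4 : 0 < δ₀ ^ 4 := by positivity
  have hE : 0 < Real.exp (δ₀ * M / 3) := Real.exp_pos _
  rw [le_div_iff₀ hδ4, Real.exp_neg]
  calc M ^ 4 * (Real.exp (δ₀ * M / 3))⁻¹ * δ₀ ^ 4
      = δ₀ ^ 4 * M ^ 4 * (Real.exp (δ₀ * M / 3))⁻¹ := by ring
    _ ≤ 1944 * Real.exp (δ₀ * M / 3) * (Real.exp (δ₀ * M / 3))⁻¹ :=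
        mul_le_mul_of_nonneg_right key (inv_nonneg.mpr hE.le)
    _ = 1944 := by field_simp

/-- **p. 20, ll. 26–27 [PDF 20]** (`p0020:L26–L27`), verbatim: «We assume that (LM)⁴α₀, (LM)⁴α₁, (LM)⁴α₄, (LM)⁴γ₂ are bounded
by a constant independent of M, for example by 1. Then O(1)(LM)⁴α₅ + exp(−½(κ₁ − 1)) is bounded by an absolute constant.» —
PROVED from the recalled definition of α₅ (`Alpha5RecallPrinted` with nonnegative O(·) constants) and `B13.Consts.R21`, with
the explicit M-INDEPENDENT constant `A·(1944·A₃L⁴∕δ₀⁴ + 2A₄ + A₅ + 1) + exp(−½(κ₁ − 1))` (`A` = the «O(1)»; `M ≥ 0`,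
`δ₀ > 0`). [cite: Balaban1988RG2Cluster, p.20 ll.24–27 (before the definition of C₃)] -/
theorem absConst20_of_R21 {A₃ A₄ A₅ A : ℝ} (h5 : Alpha5RecallPrinted c A₃ A₄ A₅) (h21 : c.R21) (hA₃ : 0 ≤ A₃)
    (hA₄ : 0 ≤ A₄) (hA₅ : 0 ≤ A₅) (hA : 0 ≤ A) (hM : 0 ≤ c.M) (hδ₀ : 0 < c.δ₀) :
    A * ((c.L : ℝ) * c.M) ^ 4 * c.α₅ + Real.exp (-((c.κ₁ - 1) / 2)) ≤
      A * (A₃ * (1944 * (c.L : ℝ) ^ 4 / c.δ₀ ^ 4) + 2 * A₄ + A₅ + 1) + Real.exp (-((c.κ₁ - 1) / 2)) := by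
  obtain ⟨h0, h1, h4, hγ⟩ := h21
  have h5' : c.α₅ ≤ A₃ * Real.exp (-(c.δ₀ * c.M / 3)) + A₄ * (c.α₀ + c.α₁) + A₅ * c.α₄ + c.γ₂ := h5
  have hL4 : 0 ≤ (c.L : ℝ) ^ 4 := by positivity
  have hLM0 : 0 ≤ ((c.L : ℝ) * c.M) ^ 4 := by positivity
  have hLM4 : ((c.L : ℝ) * c.M) ^ 4 = (c.L : ℝ) ^ 4 * c.M ^ 4 := by ring
  have hexp := pow_four_mul_exp_neg_le hM hδ₀
  -- the four summands of (LM)⁴α₅, each bounded independently of M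
  have t1 : ((c.L : ℝ) * c.M) ^ 4 * (A₃ * Real.exp (-(c.δ₀ * c.M / 3))) ≤ A₃ * (1944 * (c.L : ℝ) ^ 4 / c.δ₀ ^ 4) := by
    rw [hLM4]
    calc (c.L : ℝ) ^ 4 * c.M ^ 4 * (A₃ * Real.exp (-(c.δ₀ * c.M / 3)))
        = A₃ * (c.L : ℝ) ^ 4 * (c.M ^ 4 * Real.exp (-(c.δ₀ * c.M / 3))) := by ring
      _ ≤ A₃ * (c.L : ℝ) ^ 4 * (1944 / c.δ₀ ^ 4) :=
          mul_le_mul_of_nonneg_left hexp (mul_nonneg hA₃ hL4)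
      _ = A₃ * (1944 * (c.L : ℝ) ^ 4 / c.δ₀ ^ 4) := by ring
  have t2 : ((c.L : ℝ) * c.M) ^ 4 * (A₄ * (c.α₀ + c.α₁)) ≤ 2 * A₄ := by
    have : ((c.L : ℝ) * c.M) ^ 4 * (A₄ * (c.α₀ + c.α₁)) =
        A₄ * (((c.L : ℝ) * c.M) ^ 4 * c.α₀ + ((c.L : ℝ) * c.M) ^ 4 * c.α₁) := by ring
    rw [this]
    nlinarith
  have t3 : ((c.L : ℝ) * c.M) ^ 4 * (A₅ * c.α₄) ≤ A₅ := by
    have : ((c.L : ℝ) * c.M) ^ 4 * (A₅ * c.α₄) = A₅ * (((c.L : ℝ) * c.M) ^ 4 * c.α₄) := by ring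
    rw [this]
    nlinarith
  have hsum : ((c.L : ℝ) * c.M) ^ 4 * c.α₅ ≤ A₃ * (1944 * (c.L : ℝ) ^ 4 / c.δ₀ ^ 4) + 2 * A₄ + A₅ + 1 := by
    have expand : ((c.L : ℝ) * c.M) ^ 4 *
          (A₃ * Real.exp (-(c.δ₀ * c.M / 3)) + A₄ * (c.α₀ + c.α₁) + A₅ * c.α₄ + c.γ₂) =
        ((c.L : ℝ) * c.M) ^ 4 * (A₃ * Real.exp (-(c.δ₀ * c.M / 3))) +
          ((c.L : ℝ) * c.M) ^ 4 * (A₄ * (c.α₀ + c.α₁)) + ((c.L : ℝ) * c.M) ^ 4 * (A₅ * c.α₄) +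
            ((c.L : ℝ) * c.M) ^ 4 * c.γ₂ := by ring
    have hstep : ((c.L : ℝ) * c.M) ^ 4 * c.α₅ ≤ ((c.L : ℝ) * c.M) ^ 4 *
        (A₃ * Real.exp (-(c.δ₀ * c.M / 3)) + A₄ * (c.α₀ + c.α₁) + A₅ * c.α₄ + c.γ₂) :=
      mul_le_mul_of_nonneg_left h5' hLM0
    rw [expand] at hstep
    linarith
  have hmain : A * ((c.L : ℝ) * c.M) ^ 4 * c.α₅ ≤ A * (A₃ * (1944 * (c.L : ℝ) ^ 4 / c.δ₀ ^ 4) + 2 * A₄ + A₅ + 1) := by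
    rw [mul_assoc]
    exact mul_le_mul_of_nonneg_left hsum hA
  linarith

end Residual

section LogHalf

variable (S : B13.StepData) (c : B13.Consts)

/-- **p. 21, ll. 28–31 [PDF 21]** (`p0021:L28–L31`), verbatim: «The expression localized in X satisfies the bound (I.1.18)
with κ replaced by δ₀M, and with an absolute constant instead of E₀. We define ½E₀ as equal to this constant» — the
log Z^{(k)} half of (I.1.18) for the terms `Elog(X)` of `log Z^{(k)}(U_{k+1}) − log Z^{(k)}(1)` localized in X ∈ 𝐃_{k+1}, on
the spaces Uᶜ_{k+1}(X, α₀, α₁) (`S.sp2`): LITERALLY the shape (I.1.18) `B13.Bound118` with constant `½E₀` and rate `δ₀M`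
— by name, the binder `hlog` of `B13.deliverables_of_chain` (the tree's structural reading of the same sentence is the
per-LM-cube leaf `B13.LogHalfBound`, `logHalf118_of_perCube`). [cite: Balaban1988RG2Cluster, p.21 ll.28–31 (closing paragraph)] -/
def LogHalf118Printed : Prop := B13.Bound118 S.Dk1 S.sp2 S.Elog (c.E₀ / 2) (c.δ₀ * c.M)

/-- Unfolding: «(I.1.18) with κ replaced by δ₀M, and with [½E₀]» for the log-terms, written out.
[cite: Balaban1988RG2Cluster, p.21 ll.28–31 (closing paragraph)] -/
theorem logHalf118Printed_iff :
    LogHalf118Printed S c ↔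
      ∀ X φ, φ ∈ S.sp2 X → ‖S.Elog X φ‖ ≤ c.E₀ / 2 * Real.exp (-(c.δ₀ * c.M) * S.Dk1.dj X) :=
  Iff.rfl

/-- The printed sentence from the tree's per-LM-cube leaf: `‖Elog(X)‖ ≤ B·nX(X)·e^{−(δ₀M + 1)d_{k+1}(X)}` (`B13.LogHalfBound`
at rate δ₀M + 1), the volume bound `nX(X) ≤ c₁(1 + d_{k+1}(X))` (`B13.VolBoundK1`, the repaired (2.30) at scale k + 1) and
«We define ½E₀ as equal to this constant» in the form `B·c₁ ≤ ½E₀` give `LogHalf118Printed` (`B13.bound118_of_logHalfBound`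
+ `bound118_mono`).  PROVED bookkeeping. [cite: Balaban1988RG2Cluster, p.21 ll.28–31 (closing paragraph)] -/
theorem logHalf118_of_perCube (nX : S.Dk1.Dom → ℕ) {B c₁ : ℝ} (hB : 0 ≤ B)
    (hlog : B13.LogHalfBound S.Dk1 S.sp2 S.Elog nX B (c.δ₀ * c.M + 1)) (hvol : B13.VolBoundK1 S.Dk1 nX c₁)
    (hdef : B * c₁ ≤ c.E₀ / 2) (hE₀ : 0 ≤ c.E₀) : LogHalf118Printed S c := by
  have h := B13.bound118_of_logHalfBound S.Dk1 S.sp2 S.Elog nX hB hlog hvol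
  have h' : B13.Bound118 S.Dk1 S.sp2 S.Elog (B * c₁) (c.δ₀ * c.M) := by
    simpa only [add_sub_cancel_right] using h
  exact B13.bound118_mono S.Dk1 S.sp2 S.Elog hdef le_rfl (by linarith) h'

end LogHalf

/-! ## §2  The bundle: the printed statements of pp. 18–22 as hypotheses, by name -/

/-- **Carriers of the block-30 bundle** beyond the step carrier `S : B13.StepData` and the constants `c : B13.Consts` —
plain data, no instances: `cubes Y` = the π_k-cubes of the localization domain `Y ∈ 𝐃_k` (the footprints over which (2.27)
and (2.29) sum, `B13FamilySum.coveringFamilies`; `Cube` is a parameter so that its decidable equality is a hypothesis,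
not an instance of this file); `cl Z` = p. 19 «the smallest localization domain from 𝐃_{k+1} containing Z̃» (the map of
(2.36), `B13.Ineq236With`); `A₃, A₄, A₅` = the three O(·) constants of the recalled definition of α₅ (p. 20).
[cite: Balaban1988RG2Cluster, (2.27)–(2.36) pp.18–19 and p.20] -/
structure Carriers (S : B13.StepData) (Cube : Type) where
  cubes : S.Dk.Dom → Finset Cube
  cl : S.Dk.Dom → S.Dk1.Dom
  A₃ : ℝ
  A₄ : ℝ
  A₅ : ℝ

/-- **BLOCK 30 BUNDLE — the printed statements of [Balaban1988RG2Cluster] pp. 18–22 AS HYPOTHESES, BY NAME**, in page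
order.  One field per statement, each a reference to the declaration of record typing it (nothing restated):
`i227` — (2.27) p. 18 for every connected union `Y₀ ∈ 𝐃_k` (`B13FamilySum.Ineq227`, constant 5); `r15` — p. 18 «Assuming
2E₀ε₁C₁α₄⁻¹α₆⁻¹M^q exp C₂κ₁ exp 5κ ≤ 1» (`B13.Consts.R15`); `i229` — (2.29) p. 18 for every connected `Y₀ ∈ 𝐃_k` («one of the components»),
the sum over the families 𝐃 of (2.2) with ∪𝐃 = Y₀ (`B13FamilySum.coveringFamilies`) at the printed rate δκ — the
tree's `B13FamilySum.Ineq229` (every finite `Y₀`) implies it (`i229_of_ineq229`); `r16` — p. 18 «(1/20)γ₂ε₁²/γ² ≥ 4κ» (`B13.Consts.R16`); `eps2le` — p. 19 «the assumption ε₂ ≤ 1»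
(`Eps2LeOnePrinted`); `exple` — p. 19 «exp(−(1/20)γ₂ε₁²/γ²) ≤ ε₂» (`ExpLeEps2Printed`); `i236` — (2.36) p. 19 «2d_k(Z_i) ≥
Ld_{k+1}(Z′_i)» (`B13.Ineq236Printed`, the printed factor L∕2); `r18half` — p. 20 «assuming that (L+2)⁴O(1)ε₂ ≤ ½»
(`B13Step237.R18half`, O(1) = `c.A₁`); `r18` — p. 20 «Assuming that 2(L+2)⁴O(1)ε₂ exp 5κ ≤ 1» (`B13Step237.R18`); `r20` —
p. 20 «we assume that ½(κ₁ − 1) ≥ 2Lκ» (`B13Ineq232.R20`); `a5` — p. 20 the recalled definition of α₅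
(`Alpha5RecallPrinted`); `r21` — p. 20 «(LM)⁴α₀, (LM)⁴α₁, (LM)⁴α₄, (LM)⁴γ₂ … bounded … by 1» (`B13.Consts.R21`); `restr` —
LEMMA 3's antecedent «Under all the above restrictions on the constants M, κ, κ₁, α₀, α₁, α₄, α₆, γ₂, γ, ε₁» (the carrier's
reader-owned conjunction `S.Restr`, of which the members `r15 … r24` are the clauses PRINTED on pp. 18–21); `lemma3` —
LEMMA 3 (2.38) p. 20 (`B13.Lemma3Printed`, verbatim there); `step26` — (2.39)–(2.41) p. 21 «To the above sum we can repeat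
all the considerations and bounds of the paper [26] … This yields (2.41)» (`B13.CammarotaStep`); `r22`, `r23` — p. 21
«(1 − 10δ)½L = 1», «O(1)C₃ε₁ ≤ ½E₀» (`B13.Consts.R22`, `R23`); `repr17` — p. 21 «For this expression we construct the
representation (I.1.7) using the generalized random walk expansion for Z^{(k)}(U_{k+1})» (`S.Repr17`); `analyticLog` —
p. 21 «we extend them to analytic functions of U, J» (the log-terms on the spaces Uᶜ_{k+1}(X, α₀, α₁), `S.Analytic`);
`logHalf` — p. 21 «satisfies the bound (I.1.18) with κ replaced by δ₀M, and with [½E₀]» (`LogHalf118Printed`); `r24` —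
p. 21 «we take M sufficiently large, so that δ₀M ≥ κ» (`B13.Consts.R24`); `gauge` — pp. 21–22 the gauge invariance of
the terms of A_{k+1} in the representation (I.1.6) («the expressions (2.14) are gauge invariant … We extend them to
constant functions on whole orbits … completes the proof of the inductive assumptions for the action A_{k+1}»; the tree's
reading `B13.Deliverables.gauge`).  Hypothesis slot only; (2.30) and (2.32) are deliberately NOT members (refuted as
printed, see the module docstring).
[cite: Balaban1988RG2Cluster, (2.27)–(2.37) pp.18–20, Lemma 3 (2.38) p.20, (2.39)–(2.41) p.21, pp.21–22 (closing remarks)] -/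
structure Hyp (S : B13.StepData) (c : B13.Consts) {Cube : Type} [DecidableEq Cube] (X : Carriers S Cube) : Prop where
  i227 : ∀ Y₀ : S.Dk.Dom,
    B13FamilySum.Ineq227 (Finset.univ : Finset S.Dk.Dom) X.cubes S.Dk.dj (X.cubes Y₀) (S.Dk.dj Y₀) 5
  r15 : c.R15
  i229 : ∀ Y₀ : S.Dk.Dom,
    ∑ D ∈ B13FamilySum.coveringFamilies (Finset.univ : Finset S.Dk.Dom) X.cubes (X.cubes Y₀),
      ∏ Y ∈ D, c.α₆ * Real.exp (-(c.δ * c.κ * S.Dk.dj Y)) ≤ 1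
  r16 : c.R16
  eps2le : Eps2LeOnePrinted c
  exple : ExpLeEps2Printed c
  i236 : B13.Ineq236Printed S.Dk S.Dk1 X.cl c.L
  r18half : B13Step237.R18half c c.A₁
  r18 : B13Step237.R18 c c.A₁
  r20 : B13Ineq232.R20 c
  a5 : Alpha5RecallPrinted c X.A₃ X.A₄ X.A₅
  r21 : c.R21
  restr : S.Restr
  lemma3 : B13.Lemma3Printed S c
  step26 : B13.CammarotaStep S c
  r22 : c.R22
  r23 : c.R23
  repr17 : S.Repr17
  analyticLog : ∀ Xd : S.Dk1.Dom, S.Analytic (S.Elog Xd) (S.sp2 Xd)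
  logHalf : LogHalf118Printed S c
  r24 : c.R24
  gauge : ∀ Xd : S.Dk1.Dom, S.GaugeInv (S.Etot Xd)

variable {S : B13.StepData} {c : B13.Consts} {Cube : Type} [DecidableEq Cube] {X : Carriers S Cube}

/-- (2.38) out of the bundle: LEMMA 3 applied to its antecedent «Under all the above restrictions». Bookkeeping.
[cite: Balaban1988RG2Cluster, Lemma 3 (2.38) p.20] -/
theorem Hyp.bound238 (h : Hyp S c X) : B13.Bound238 S c := h.lemma3 h.restr

/-- (2.41) out of the bundle: the [26]-step applied to (2.38). Bookkeeping. [cite: Balaban1988RG2Cluster, (2.41) p.21] -/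
theorem Hyp.bound241 (h : Hyp S c X) : B13.Bound241 S c := h.step26 h.bound238

/-- p. 21 «The inequality (2.41) and the assumptions imply the inequality (I.1.18), with ½E₀ instead of E₀, for the terms of
the effective action E^{(k+1)} in (I.1.3)» — from the bundle by the tree's PROVED `B13.bound118_of_bound241`.
[cite: Balaban1988RG2Cluster, p.21 (after (2.41))] -/
theorem Hyp.bound118_newTerm (h : Hyp S c X) : B13.Bound118 S.Dk1 S.sp2 S.Ek1 (c.E₀ / 2) c.κ :=
  B13.bound118_of_bound241 S c h.bound241 h.r22 h.r23

/-- p. 21 «This yields the bounds (I.1.18) for terms of the effective action in the representation (I.1.6) also» — the two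
halves (`bound118_newTerm`, `logHalf`) with «δ₀M ≥ κ» (`r24`) give (I.1.18) with E₀ and κ for `E^{(k+1)}(X) + Elog(X)`
(`B13.StepData.Etot`), by the tree's PROVED `B13.bound118_of_halves` (`E₀ ≥ 0`). [cite: Balaban1988RG2Cluster, p.21 (closing paragraph)] -/
theorem Hyp.bound118_total (h : Hyp S c X) (hE₀ : 0 ≤ c.E₀) : B13.Bound118 S.Dk1 S.sp2 S.Etot c.E₀ c.κ :=
  B13.bound118_of_halves S.Dk1 S.sp2 S.Etot S.Ek1 S.Elog c.E₀ c.κ (c.δ₀ * c.M) hE₀ h.r24 (fun _ _ _ => rfl)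
    h.bound118_newTerm h.logHalf

/-- **The consumer's form (pp. 20–22)**: the bundle together with the p. 15 analyticity of the gathered terms on
Uᶜ_{k+1}(X, α₀, α₁) (block 29's page; «This is the analyticity statement in the inductive assumptions») and `E₀ ≥ 0` gives
[II]'s delivered clauses for A_{k+1}, `B13.Deliverables S c` ((I.1.7), analyticity, (I.1.18) with E₀ and κ, gauge
invariance) — literally `B13.deliverables_of_chain` fed from the bundle's members.  Bookkeeping. [cite: Balaban1988RG2Cluster, pp.20–22 (Lemma 3 to Thm I.3)] -/
theorem Hyp.deliverables (h : Hyp S c X) (hE₀ : 0 ≤ c.E₀) (han : ∀ Xd : S.Dk1.Dom, S.Analytic (S.Etot Xd) (S.sp2 Xd)) :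
    B13.Deliverables S c :=
  B13.deliverables_of_chain S c h.restr h.lemma3 h.step26 h.r22 h.r23 h.r24 hE₀ h.logHalf h.repr17 han h.gauge

/-- **The DAG's `b13` leaf**: at the carriers `(X.S13, X.c13)` of `DagBinding.PrintedCarriers`, the bundle's LEMMA 3
together with LEMMAS 1 and 2 (pp. 9–11, outside this block) IS the upstream leaf `b13 = B13.Lemma1Printed ∧ Lemma2Printed ∧
Lemma3Printed` of `DagBinding.Upstream.ofPrinted` (node [B13] of the K⁷ consumer).  Bookkeeping. [cite: Balaban1988RG2Cluster, Lemma 3 p.20] -/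
theorem Hyp.dag_b13 {Xc : DagBinding.PrintedCarriers} {Y : Carriers Xc.S13 Cube} (h : Hyp Xc.S13 Xc.c13 Y)
    (h1 : B13.Lemma1Printed Xc.S13 Xc.c13) (h2 : B13.Lemma2Printed Xc.S13 Xc.c13) (b9 b11 rOp rBS : Prop) :
    (DagBinding.Upstream.ofPrinted Xc b9 b11 rOp rBS).b13 :=
  (show B13.Lemma1Printed Xc.S13 Xc.c13 ∧ B13.Lemma2Printed Xc.S13 Xc.c13 ∧ B13.Lemma3Printed Xc.S13 Xc.c13 from
    ⟨h1, h2, h.lemma3⟩)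

/-- «We have used the assumption ε₂ ≤ 1» is redundant in the bundle once `κ ≥ 0`: it follows from `r15`
(`eps2LeOne_of_R15`). [cite: Balaban1988RG2Cluster, p.19 l.4 and p.18 (before (2.28))] -/
theorem Hyp.eps2le_of_r15 (h : Hyp S c X) (hκ : 0 ≤ c.κ) : Eps2LeOnePrinted c := eps2LeOne_of_R15 c hκ h.r15

/-- The p. 19 assumption at the running coupling: for `0 < g_k ≤ γ`, `exp(−(1/20)γ₂ε₁²/g_k²) ≤ ε₂` (the binder `hR17` of the
tree's (2.35) ∕ (2.38) assembly theorems). [cite: Balaban1988RG2Cluster, p.19 ll.5–6 and p.18 (after (2.32))] -/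
theorem Hyp.expLeEps2_gk (h : Hyp S c X) {g : ℝ} (hg : 0 < g) (hgγ : g ≤ c.γ) (hnum : 0 ≤ c.γ₂ * c.ε₁ ^ 2) :
    Real.exp (-(c.γ₂ * c.ε₁ ^ 2 / g ^ 2 / 20)) ≤ c.eps2 :=
  expLeEps2_at_gk c h.exple hg hgγ hnum

/-- R16 at the running coupling: for `0 < g_k ≤ γ`, `4κ ≤ (1/20)γ₂ε₁²/g_k²`. [cite: Balaban1988RG2Cluster, p.18 (after (2.32))] -/
theorem Hyp.r16_gk (h : Hyp S c X) {g : ℝ} (hg : 0 < g) (hgγ : g ≤ c.γ) (hnum : 0 ≤ c.γ₂ * c.ε₁ ^ 2) :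
    4 * c.κ ≤ c.γ₂ * c.ε₁ ^ 2 / g ^ 2 / 20 :=
  r16_at_gk c h.r16 hg hgγ hnum

/-- The tree's typed (2.29), `B13FamilySum.Ineq229` (stated for EVERY finite set of cubes `Y₀`, and PROVED there from
(1.26) and the additive volume bound: `B13FamilySum.ineq229_locDomainSys`), yields the bundle's member `i229` (the printed
case: `Y₀` a connected domain of 𝐃_k). [cite: Balaban1988RG2Cluster, (2.29) p.18] -/
theorem i229_of_ineq229 (X : Carriers S Cube)
    (h : B13FamilySum.Ineq229 (Finset.univ : Finset S.Dk.Dom) X.cubes S.Dk.dj c.α₆ (c.δ * c.κ)) (Y₀ : S.Dk.Dom) :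
    ∑ D ∈ B13FamilySum.coveringFamilies (Finset.univ : Finset S.Dk.Dom) X.cubes (X.cubes Y₀),
      ∏ Y ∈ D, c.α₆ * Real.exp (-(c.δ * c.κ * S.Dk.dj Y)) ≤ 1 :=
  h (X.cubes Y₀)

/-- The p. 20 «absolute constant» from the bundle: with nonnegative O(·) constants, `M ≥ 0`, `δ₀ > 0`,
`O(1)(LM)⁴α₅ + exp(−½(κ₁ − 1)) ≤ O(1)·(1944·A₃L⁴∕δ₀⁴ + 2A₄ + A₅ + 1) + exp(−½(κ₁ − 1))` — independent of M
(`absConst20_of_R21`). [cite: Balaban1988RG2Cluster, p.20 ll.24–27] -/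
theorem Hyp.absConst20 (h : Hyp S c X) {A : ℝ} (hA₃ : 0 ≤ X.A₃) (hA₄ : 0 ≤ X.A₄) (hA₅ : 0 ≤ X.A₅) (hA : 0 ≤ A)
    (hM : 0 ≤ c.M) (hδ₀ : 0 < c.δ₀) :
    A * ((c.L : ℝ) * c.M) ^ 4 * c.α₅ + Real.exp (-((c.κ₁ - 1) / 2)) ≤
      A * (X.A₃ * (1944 * (c.L : ℝ) ^ 4 / c.δ₀ ^ 4) + 2 * X.A₄ + X.A₅ + 1) + Real.exp (-((c.κ₁ - 1) / 2)) :=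
  absConst20_of_R21 c h.a5 h.r21 hA₃ hA₄ hA₅ hA hM hδ₀

end Literature.MathematicalPhysics.QuantumFieldTheory.Balaban1983to89.B13Carve30Lemma3MainHyp
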